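import Literature.NumberTheory.GaloisRepresentations.LocalClassFieldTheory
import Literature.NumberTheory.GaloisRepresentations.LocalReciprocity
import Literature.NumberTheory.GaloisRepresentations.LocalGaloisGroupProofs
import Literature.NumberTheory.GaloisRepresentations.WeilGroupProofs
import Literature.NumberTheory.GaloisRepresentations.WeilGroupDensityProofs
import HarnessLib

/-!
# From the reciprocity map to the local Artin map on the Weil group (trunk GalRep, item C18)

D-0014 keeps `Literature/` sorry-free by stating cited results as named facts `def X : Prop`.
This sibling file of `Literature.NumberTheory.GaloisRepresentations.LocalClassFieldTheory`
*assembles* the facts `Literature.NumberTheory.GaloisRepresentations.nonempty_localArtinData` and `Literature.NumberTheory.GaloisRepresentations.exists_isCompatible` of that file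
(existence of the local Artin map `W_F → Fˣ` in Deligne's normalisation, and its norm
functoriality) from

* the reciprocity-map facts of `Literature.NumberTheory.GaloisRepresentations.LocalReciprocity`
  (`Literature.NumberTheory.GaloisRepresentations.IsLocalReciprocityMap`, `Literature.NumberTheory.GaloisRepresentations.exists_isLocalReciprocityMap`,
  `Literature.NumberTheory.GaloisRepresentations.exists_isLocalReciprocityMap_normCompatible`: Serre, *Local Fields*, Ch. XIII §4 and
  Ch. XIV §6), and
* the density of `W_F` in `Γ_F` (`WeilGroup.denseRange_toAbsGalois`, Tate (1.4.1)), kept as a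
  hypothesis in the constructions and fed by its discharge `WeilGroup.denseRange_toAbsGalois_holds`
  (`WeilGroupDensityProofs.lean`) in the final assembly theorems `…_of_lcft`; the other
  Weil-group inputs are the
  discharged facts of `LocalGaloisGroupProofs.lean` (`IsFrobPow.mul_holds`,
  `IsFrobPow.unique_holds`, `isClosed_absInertia_holds`) and `WeilGroupProofs.lean`
  (`isTopologicalGroup_holds`, `isEmbedding_toAbsGalois_restrict_inertia_holds`), and the
  continuity of `W_F → Γ_F` (`toAbsGaloisContinuous`),

following Tate, *Number theoretic background* (Corvallis 1979), (1.4.1)–(1.4.6), and Serre,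
*Local Fields*, Ch. XIV §6, Remark 2: since `θ_F : Fˣ → 𝔄_F` is a bijection onto the image
`𝔄_F^0` of `W_F`, one puts `artin w := (θ_F⁻¹ [w])⁻¹` (the inverse implements Deligne's
sign convention: geometric Frobenius `↦` uniformiser).  Density of `W_F` enters through
`closure [Γ_F, Γ_F] = closure [W_F, W_F] ≤ I_F`, which identifies the kernel of `artin` and shows
that `Γ_F → Γ_F^ab` restricted to `I_F` is open onto the inertia group `𝔗_F` of `F^ab / F`.

## Main results

* `Literature.IsLocalReciprocityMap.artin hθ : WeilGroup F →* Fˣ` and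
  `Literature.NumberTheory.GaloisRepresentations.IsLocalReciprocityMap.toLocalArtinData`: a reciprocity map with the printed properties
  yields a `LocalArtinData F` (open quotient map, kernel `= closure [W_F, W_F]`,
  `artin (I_F) = 𝒪_Fˣ`, geometric Frobenius `↦` uniformiser), given the density of `W_F`
  in `Γ_F` (`WeilGroup.denseRange_toAbsGalois`, a named fact of `WeilGroup.lean`).
* `Literature.NumberTheory.GaloisRepresentations.IsLocalReciprocityMap.isCompatible`: norm functoriality of `θ` (`IsNormCompatible`)
  gives `LocalArtinData.IsCompatible`.
* `Literature.NumberTheory.GaloisRepresentations.nonempty_localArtinData_of_localReciprocity`,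
  `Literature.NumberTheory.GaloisRepresentations.exists_isCompatible_of_localReciprocity`: the two facts of `LocalClassFieldTheory.lean`
  follow from the named facts listed above, and `Literature.NumberTheory.GaloisRepresentations.nonempty_localArtinData_of_lcft`,
  `Literature.NumberTheory.GaloisRepresentations.exists_isCompatible_of_lcft`: the same with the density hypothesis discharged, so that the
  unconditional `exists_isCompatible_holds` now awaits only local class field theory itself
  (`exists_isLocalReciprocityMap_normCompatible_holds`).

## References

* J.-P. Serre, *Local Fields*, GTM 67, Springer 1979, Ch. XIII §4, Ch. XIV §6 (Remark 2).
  [SerreLocalFields1979]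
* J. Tate, *Number theoretic background*, Proc. Sympos. Pure Math. XXXIII (Corvallis 1977),
  Part 2, AMS 1979, (1.4.1)–(1.4.6).  [Corvallis1979]
-/

noncomputable section

open ValuativeRel Field Topology Set Filter
open scoped commutatorElement

namespace Literature.NumberTheory.GaloisRepresentations


/-! ### Commutators of the Weil group and of `Γ_F` lie in inertia -/

namespace WeilGroup

variable {F : Type*} [Field F] [ValuativeRel F] [TopologicalSpace F] [IsNonarchimedeanLocalField F]

variable (F) in
/-- The inclusion `W_F → Γ_F` as a *continuous* homomorphism (continuity is the named fact
`WeilGroup.continuous_toAbsGalois`, discharged as `WeilGroup.continuous_toAbsGalois_holds` in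
`Literature/NumberTheory/Automorphic/LParameter.lean`; the eight-line argument — the preimage of
an open `V` is the union of the generating sets `{x | x w⁻¹ ∈ I_F, x ∈ V}` — is repeated here so
that this file does not import the automorphic layer).
Ref: Tate, *Number theoretic background* (Corvallis 1979), (1.4.1). [folklore] -/
def toAbsGaloisContinuous : WeilGroup F →ₜ* absoluteGaloisGroup F where
  toMonoidHom := toAbsGalois F
  continuous_toFun := by
    refine continuous_def.mpr fun V hV => ?_
    have h : toAbsGalois F ⁻¹' V =
        ⋃ w : WeilGroup F, {x : WeilGroup F | x * w⁻¹ ∈ inertia F ∧ toAbsGalois F x ∈ V} := by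
      ext x
      simp only [mem_preimage, mem_iUnion, mem_setOf_eq]
      exact ⟨fun hx => ⟨x, by simp, hx⟩, fun ⟨_, _, hx⟩ => hx⟩
    change IsOpen (toAbsGalois F ⁻¹' V)
    rw [h]
    exact isOpen_iUnion fun w => TopologicalSpace.isOpen_generateFrom_of_mem ⟨w, V, hV, rfl⟩

/-- Unfolding lemma for `toAbsGaloisContinuous`.  Ref: Tate, Corvallis 1979, (1.4.1). [folklore] -/
@[simp]
theorem toAbsGaloisContinuous_apply (w : WeilGroup F) :
    toAbsGaloisContinuous F w = toAbsGalois F w :=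
  rfl

/-- `W_F → Γ_F` is continuous (from the bundled `toAbsGaloisContinuous`).
Ref: Tate, *Number theoretic background* (Corvallis 1979), (1.4.1). [folklore] -/
theorem continuous_toAbsGalois' : Continuous (toAbsGalois F) :=
  (toAbsGaloisContinuous F).continuous

/-- `[W_F, W_F] ≤ I_F`: the degree `W_F → ℤ` is a homomorphism to an abelian group, with kernel
the inertia group.
Ref: Tate, *Number theoretic background* (Corvallis 1979), (1.4.1). [folklore] -/
theorem commutator_le_inertia : commutator (WeilGroup F) ≤ inertia F := by
  intro w hw
  have hmul : IsFrobPow.mul (F := F) := IsFrobPow.mul_holds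
  have huniq : IsFrobPow.unique (F := F) := IsFrobPow.unique_holds
  have hker := Abelianization.commutator_subset_ker (degHom F hmul huniq) hw
  rw [MonoidHom.mem_ker, degHom_apply] at hker
  have hdeg : deg w = 0 := by simpa using congr(Multiplicative.toAdd $hker)
  exact (deg_eq_zero_iff_mem_inertia hmul huniq).mp hdeg

/-- The image of `[W_F, W_F]` in `Γ_F` lies in the absolute inertia group `I_F`.
Ref: Tate, *Number theoretic background* (Corvallis 1979), (1.4.1). [folklore] -/
theorem map_commutator_le_absInertia :
    (commutator (WeilGroup F)).map (toAbsGalois F) ≤ absInertia F := by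
  rw [← inertia_map_toAbsGalois]
  exact Subgroup.map_mono commutator_le_inertia

/-- Density of `W_F` in `Γ_F` gives `[Γ_F, Γ_F] ≤ closure [W_F, W_F]` (closure in `Γ_F`): the
commutator map `Γ_F × Γ_F → Γ_F` is continuous and `W_F × W_F` is dense.
Ref: Tate, *Number theoretic background* (Corvallis 1979), (1.4.1). [folklore] -/
theorem commutator_absGalois_le_closure (hdense : denseRange_toAbsGalois F) :
    commutator (absoluteGaloisGroup F) ≤
      ((commutator (WeilGroup F)).map (toAbsGalois F)).topologicalClosure := by
  set S := ((commutator (WeilGroup F)).map (toAbsGalois F)).topologicalClosure with hS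
  rw [commutator_def, Subgroup.commutator_def]
  refine Subgroup.closure_le _ |>.mpr ?_
  rintro g ⟨a, -, b, -, rfl⟩
  -- the commutator map and the dense set `W_F × W_F`
  let c : absoluteGaloisGroup F × absoluteGaloisGroup F → absoluteGaloisGroup F :=
    fun p => ⁅p.1, p.2⁆
  have hc : Continuous c := by
    simp only [c, commutatorElement_def]
    fun_prop
  have hD : DenseRange (Prod.map (toAbsGalois F) (toAbsGalois F)) := hdense.prodMap hdense
  have himage : c '' range (Prod.map (toAbsGalois F) (toAbsGalois F)) ⊆ S := by
    rintro _ ⟨_, ⟨⟨w₁, w₂⟩, rfl⟩, rfl⟩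
    refine Subgroup.le_topologicalClosure _ ⟨⁅w₁, w₂⁆, ?_, ?_⟩
    · exact Subgroup.commutator_mem_commutator (Subgroup.mem_top w₁) (Subgroup.mem_top w₂)
    · simp [c, commutatorElement_def]
  have hmem : c (a, b) ∈ c '' closure (range (Prod.map (toAbsGalois F) (toAbsGalois F))) :=
    ⟨(a, b), by rw [hD.closure_range]; exact mem_univ _, rfl⟩
  have := (image_closure_subset_closure_image hc) hmem
  exact (Subgroup.isClosed_topologicalClosure _).closure_subset_iff.mpr himage this

/-- `closure [Γ_F, Γ_F] = closure [W_F, W_F]` (closures in `Γ_F`), by density of `W_F`.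
Ref: Tate, *Number theoretic background* (Corvallis 1979), (1.4.1). [folklore] -/
theorem topologicalClosure_commutator_absGalois_eq (hdense : denseRange_toAbsGalois F) :
    (commutator (absoluteGaloisGroup F)).topologicalClosure =
      ((commutator (WeilGroup F)).map (toAbsGalois F)).topologicalClosure := by
  refine le_antisymm ?_ ?_
  · exact Subgroup.topologicalClosure_minimal _ (commutator_absGalois_le_closure hdense)
      (Subgroup.isClosed_topologicalClosure _)
  · refine Subgroup.topologicalClosure_mono ?_
    rw [commutator, Subgroup.map_commutator]
    exact Subgroup.commutator_mono le_top le_top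

/-- `closure [Γ_F, Γ_F] ≤ I_F`: commutators of `W_F` lie in `I_F`, `W_F` is dense and `I_F` is
closed.  Hence the kernel of `Γ_F → Γ_F^ab` consists of inertia elements.
Ref: Serre, *Local Fields* (1979), Ch. XIII §4, p. 201 (`F_nr ⊆ F^ab`). [folklore] -/
theorem topologicalClosure_commutator_absGalois_le_absInertia (hdense : denseRange_toAbsGalois F) :
    (commutator (absoluteGaloisGroup F)).topologicalClosure ≤ absInertia F := by
  rw [topologicalClosure_commutator_absGalois_eq hdense]
  exact Subgroup.topologicalClosure_minimal _ map_commutator_le_absInertia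
    (isClosed_absInertia_holds F)

/-- The preimage in `W_F` of `closure [Γ_F, Γ_F]` is the closure of `[W_F, W_F]` for the Weil
topology: `W_F ∩ G(F̄/F^ab) = closure [W_F, W_F]`.  Uses: continuity of `W_F → Γ_F`, density of
`W_F`, and that the Weil topology restricts to the Krull topology on the inertia group.
Ref: Tate, *Number theoretic background* (Corvallis 1979), (1.4.1)–(1.4.4). [folklore] -/
theorem coe_comap_topologicalClosure_commutator (hdense : denseRange_toAbsGalois F) :
    (((commutator (absoluteGaloisGroup F)).topologicalClosure.comap (toAbsGalois F) :
      Subgroup (WeilGroup F)) : Set (WeilGroup F)) =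
      closure (commutator (WeilGroup F) : Set (WeilGroup F)) := by
  have hcont : Continuous (toAbsGalois F) := continuous_toAbsGalois'
  have hemb : IsEmbedding ((inertia F : Set (WeilGroup F)).restrict (toAbsGalois F)) :=
    isEmbedding_toAbsGalois_restrict_inertia_holds F
  refine Subset.antisymm ?_ ?_
  · intro w hw
    simp only [SetLike.mem_coe, Subgroup.mem_comap] at hw
    -- `w` lies in the inertia group
    have hwI : w ∈ inertia F :=
      mem_inertia_iff.mpr (topologicalClosure_commutator_absGalois_le_absInertia hdense hw)
    rw [topologicalClosure_commutator_absGalois_eq hdense] at hw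
    -- work inside the subspace `I_F ⊆ W_F`, on which `toAbsGalois` is an embedding
    let s : Set (inertia F : Set (WeilGroup F)) :=
      Subtype.val ⁻¹' (commutator (WeilGroup F) : Set (WeilGroup F))
    have himage : (inertia F : Set (WeilGroup F)).restrict (toAbsGalois F) '' s =
        ((commutator (WeilGroup F)).map (toAbsGalois F) : Set (absoluteGaloisGroup F)) := by
      apply Subset.antisymm
      · rintro _ ⟨⟨x, hxI⟩, hxc, rfl⟩
        exact ⟨x, hxc, rfl⟩
      · rintro _ ⟨x, hxc, rfl⟩
        exact ⟨⟨x, commutator_le_inertia hxc⟩, hxc, rfl⟩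
    have hx : (⟨w, hwI⟩ : (inertia F : Set (WeilGroup F))) ∈ closure s := by
      rw [hemb.closure_eq_preimage_closure_image, mem_preimage, himage]
      exact hw
    rw [closure_subtype] at hx
    exact closure_mono (image_preimage_subset _ _) hx
  · refine (IsClosed.closure_subset_iff ?_).mpr ?_
    · exact (Subgroup.isClosed_topologicalClosure _).preimage hcont
    · intro w hw
      simp only [SetLike.mem_coe, Subgroup.mem_comap]
      refine Subgroup.le_topologicalClosure _ ?_
      have h : (commutator (WeilGroup F)).map (toAbsGalois F) ≤
          commutator (absoluteGaloisGroup F) := by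
        rw [commutator, Subgroup.map_commutator]
        exact Subgroup.commutator_mono le_top le_top
      exact h ⟨w, hw, rfl⟩

end WeilGroup

/-! ### Units of a local field: uniformisers and the unit group -/

section Units

variable {F : Type*} [Field F] [ValuativeRel F] [TopologicalSpace F] [IsNonarchimedeanLocalField F]

/-- There is a uniformiser in `Fˣ`.  Ref: Serre, *Local Fields* (1979), Ch. II §1. [folklore] -/
theorem exists_units_isUniformizer : ∃ ϖ : Fˣ, (valuation F).IsUniformizer (ϖ : F) := by
  obtain ⟨π, hπ⟩ := Valuation.exists_isUniformizer_of_isCyclic_of_nontrivial (valuation F)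
  exact ⟨Units.mk0 (π : F) hπ.ne_zero, hπ⟩

/-- A unit of `𝒪_F` times a uniformiser is a uniformiser.
Ref: Serre, *Local Fields* (1979), Ch. II §1. [folklore] -/
theorem isUniformizer_unitGroup_mul {ϖ u : Fˣ} (hϖ : (valuation F).IsUniformizer (ϖ : F))
    (hu : u ∈ (valuation F).valuationSubring.unitGroup) :
    (valuation F).IsUniformizer ((u * ϖ : Fˣ) : F) := by
  rw [Valuation.mem_unitGroup_iff] at hu
  rw [Valuation.IsUniformizer.iff, Units.val_mul, map_mul, hu, one_mul, hϖ.val]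

/-- The unit group `𝒪_Fˣ = {x | v x = 1}` is open in `Fˣ`.
Ref: Serre, *Local Fields* (1979), Ch. II §1. [folklore] -/
theorem isOpen_unitGroup :
    IsOpen ((valuation F).valuationSubring.unitGroup : Set Fˣ) := by
  have h : ((valuation F).valuationSubring.unitGroup : Set Fˣ) =
      Units.val ⁻¹' {x : F | (valuation F).restrict x = 1} := by
    ext x
    rw [SetLike.mem_coe, Valuation.mem_unitGroup_iff, mem_preimage, mem_setOf_eq,
      Valuation.restrict_eq_one_iff]
  rw [h]
  exact (Valuation.isOpen_sphere (v := valuation F) one_ne_zero).preimage Units.continuous_val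

end Units

/-! ### From a reciprocity map to a local Artin datum (Tate (1.4.1); Serre XIV §6 Remark 2) -/

namespace IsLocalReciprocityMap

variable {F : Type*} [Field F] [ValuativeRel F] [TopologicalSpace F] [IsNonarchimedeanLocalField F]
variable {θ : Fˣ →* absoluteGaloisGroupAbelianization F}

/-- The class in `Γ_F^ab` of an element of `W_F` lies in the image of the reciprocity map
(`range_eq`: the image is `𝔄_F^0`).  Ref: Serre, *Local Fields* (1979), Ch. XIV §6, Remark 2.
[folklore] -/
theorem absGaloisAbProj_toAbsGalois_mem_range (hθ : IsLocalReciprocityMap F θ) (w : WeilGroup F) :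
    absGaloisAbProj F (WeilGroup.toAbsGalois F w) ∈ θ.range := by
  rw [hθ.range_eq]
  exact ⟨_, (show ↥(weilSubgroup F) from w).2, rfl⟩

/-- The homomorphism `W_F →* θ(Fˣ) = 𝔄_F^0`, `w ↦ [w]` (restriction to `F^ab`).
Ref: Serre, *Local Fields* (1979), Ch. XIV §6, Remark 2. [folklore] -/
def weilToRange (hθ : IsLocalReciprocityMap F θ) : WeilGroup F →* θ.range :=
  ((absGaloisAbProj F).comp (WeilGroup.toAbsGalois F)).codRestrict θ.range
    (absGaloisAbProj_toAbsGalois_mem_range hθ)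

/-- Serre's (arithmetic) normalisation of the Artin map on the Weil group:
`w ↦ θ⁻¹ [w] : W_F →* Fˣ`, the inverse of the isomorphism `Fˣ ≅ 𝔄_F^0` pulled back to `W_F`
(arithmetic Frobenius `↦` uniformiser).
Ref: Serre, *Local Fields* (1979), Ch. XIV §6, Remark 2 and Exercise 1. [folklore] -/
def artinArith (hθ : IsLocalReciprocityMap F θ) : WeilGroup F →* Fˣ :=
  (MonoidHom.ofInjective hθ.injective).symm.toMonoidHom.comp (weilToRange hθ)

/-- Defining property of `artinArith`: `θ (artinArith w) = [w]` in `Γ_F^ab`.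
Ref: Serre, *Local Fields* (1979), Ch. XIV §6, Remark 2. [folklore] -/
theorem theta_artinArith (hθ : IsLocalReciprocityMap F θ) (w : WeilGroup F) :
    θ (hθ.artinArith w) = absGaloisAbProj F (WeilGroup.toAbsGalois F w) :=
  MonoidHom.apply_ofInjective_symm hθ.injective _

/-- The local Artin map on the Weil group in Deligne's normalisation:
`artin w = (θ⁻¹ [w])⁻¹ : W_F →* Fˣ` (geometric Frobenius `↦` uniformiser).
Ref: Tate, *Number theoretic background* (Corvallis 1979), (1.4.1); Deligne, *Les constantes des
équations fonctionnelles* (1973), §2.3. [folklore] -/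
def artin (hθ : IsLocalReciprocityMap F θ) : WeilGroup F →* Fˣ :=
  invMonoidHom.comp (artinArith hθ)

/-- `artin w = (artinArith w)⁻¹`.  Ref: Tate, Corvallis 1979, (1.4.1). [folklore] -/
@[simp]
theorem artin_apply (hθ : IsLocalReciprocityMap F θ) (w : WeilGroup F) :
    hθ.artin w = (hθ.artinArith w)⁻¹ :=
  rfl

/-- Defining property of `artin`: `θ (artin w)⁻¹ = [w]` in `Γ_F^ab`.
Ref: Tate, *Number theoretic background* (Corvallis 1979), (1.4.1). [folklore] -/
theorem theta_artin_inv (hθ : IsLocalReciprocityMap F θ) (w : WeilGroup F) :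
    θ (hθ.artin w)⁻¹ = absGaloisAbProj F (WeilGroup.toAbsGalois F w) := by
  rw [artin_apply, inv_inv, theta_artinArith]

/-- `artin w = x ↔ θ x⁻¹ = [w]` (`θ` is injective).
Ref: Serre, *Local Fields* (1979), Ch. XIV §6, Cor. 2 (i) to Thm. 1. [folklore] -/
theorem artin_eq_iff (hθ : IsLocalReciprocityMap F θ) {w : WeilGroup F} {x : Fˣ} :
    hθ.artin w = x ↔ θ x⁻¹ = absGaloisAbProj F (WeilGroup.toAbsGalois F w) := by
  constructor
  · rintro rfl
    exact theta_artin_inv hθ w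
  · intro h
    apply inv_injective
    apply hθ.injective
    rw [theta_artin_inv, h]

/-- `artin` is surjective: the image of `θ` is all of `𝔄_F^0 = [W_F]`.
Ref: Serre, *Local Fields* (1979), Ch. XIV §6, Remark 2. [folklore] -/
theorem artin_surjective (hθ : IsLocalReciprocityMap F θ) : Function.Surjective hθ.artin := by
  intro x
  have h1 : θ x⁻¹ ∈ (weilSubgroup F).map (absGaloisAbProj F) := hθ.range_eq ▸ ⟨x⁻¹, rfl⟩
  obtain ⟨σ, hσ, hσ'⟩ := h1
  refine ⟨WeilGroup.mk σ ((mem_weilSubgroup_iff IsFrobPow.mul_holds).mp hσ), ?_⟩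
  rw [artin_eq_iff, WeilGroup.toAbsGalois_mk, hσ']

/-- The kernel of `artin` is `W_F ∩ closure [Γ_F, Γ_F]` (the kernel of `W_F → Γ_F^ab`).
Ref: Tate, *Number theoretic background* (Corvallis 1979), (1.4.1). [folklore] -/
theorem mem_ker_artin_iff (hθ : IsLocalReciprocityMap F θ) {w : WeilGroup F} :
    w ∈ hθ.artin.ker ↔
      WeilGroup.toAbsGalois F w ∈ (commutator (absoluteGaloisGroup F)).topologicalClosure := by
  rw [MonoidHom.mem_ker, artin_eq_iff, inv_one, map_one, eq_comm]
  exact QuotientGroup.eq_one_iff _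

/-- `ker artin = toAbsGalois⁻¹ (closure [Γ_F, Γ_F])` as subgroups of `W_F`.
Ref: Tate, *Number theoretic background* (Corvallis 1979), (1.4.1). [folklore] -/
theorem ker_artin_eq_comap (hθ : IsLocalReciprocityMap F θ) :
    hθ.artin.ker =
      ((commutator (absoluteGaloisGroup F)).topologicalClosure).comap (WeilGroup.toAbsGalois F) :=
  Subgroup.ext fun _ => mem_ker_artin_iff hθ

/-- `ker artin = closure [W_F, W_F]` (closure for the Weil topology), given the density of `W_F`
in `Γ_F`.
Ref: Tate, *Number theoretic background* (Corvallis 1979), (1.4.1). [folklore] -/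
theorem coe_ker_artin (hθ : IsLocalReciprocityMap F θ)
    (hdense : WeilGroup.denseRange_toAbsGalois F) :
    (hθ.artin.ker : Set (WeilGroup F)) =
      closure (commutator (WeilGroup F) : Set (WeilGroup F)) := by
  rw [ker_artin_eq_comap]
  exact WeilGroup.coe_comap_topologicalClosure_commutator hdense

/-- `artin` maps the inertia group into the unit group (`θ(U_F) = 𝔗_F ∋ [w]` for `w ∈ I_F`).
Ref: Serre, *Local Fields* (1979), Ch. XIII §4, Cor. to Prop. 13. [folklore] -/
theorem artin_mem_unitGroup (hθ : IsLocalReciprocityMap F θ) {w : WeilGroup F}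
    (hw : w ∈ WeilGroup.inertia F) : hθ.artin w ∈ (valuation F).valuationSubring.unitGroup := by
  have h1 : absGaloisAbProj F (WeilGroup.toAbsGalois F w) ∈
      (absInertia F).map (absGaloisAbProj F) := ⟨_, hw, rfl⟩
  rw [← hθ.map_unitGroup] at h1
  obtain ⟨u, hu, hu'⟩ := h1
  have h2 : hθ.artin w = u⁻¹ := by rw [artin_eq_iff, inv_inv, hu']
  rw [h2]
  exact inv_mem hu

/-- `artin (I_F) = U_F = 𝒪_Fˣ`.
Ref: Serre, *Local Fields* (1979), Ch. XIII §4, Cor. to Prop. 13; Ch. XIV §6, Cor. 2 (ii).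
[folklore] -/
theorem map_inertia_artin (hθ : IsLocalReciprocityMap F θ) :
    (WeilGroup.inertia F).map hθ.artin = (valuation F).valuationSubring.unitGroup := by
  ext u
  constructor
  · rintro ⟨w, hw, rfl⟩
    exact artin_mem_unitGroup hθ hw
  · intro hu
    have h1 : θ u⁻¹ ∈ (absInertia F).map (absGaloisAbProj F) := by
      rw [← hθ.map_unitGroup]
      exact ⟨u⁻¹, inv_mem hu, rfl⟩
    obtain ⟨σ, hσ, hσ'⟩ := h1
    refine ⟨WeilGroup.mk σ ⟨0, isFrobPow_zero_iff_mem_absInertia.mpr hσ⟩, ?_, ?_⟩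
    · show WeilGroup.mk σ _ ∈ WeilGroup.inertia F
      rw [WeilGroup.mem_inertia_iff, WeilGroup.toAbsGalois_mk]
      exact hσ
    · rw [artin_eq_iff, WeilGroup.toAbsGalois_mk, hσ']

/-- Deligne's normalisation holds for `artin`: an element of degree `-1` (geometric Frobenius) is
sent to a uniformiser.  (A uniformiser `ϖ` has `θ ϖ = [σ₀]` with `σ₀` an arithmetic Frobenius,
so `artin σ₀ = ϖ⁻¹`, and `w σ₀ ∈ I_F` is sent to a unit.)
Ref: Serre, *Local Fields* (1979), Ch. XIII §4, Prop. 13; Tate, Corvallis 1979, (1.4.1).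
[folklore] -/
theorem isUniformizer_artin (hθ : IsLocalReciprocityMap F θ)
    (w : WeilGroup F) (hw : WeilGroup.deg w = -1) :
    (valuation F).IsUniformizer (hθ.artin w : F) := by
  have hmul : IsFrobPow.mul (F := F) := IsFrobPow.mul_holds
  have huniq : IsFrobPow.unique (F := F) := IsFrobPow.unique_holds
  obtain ⟨ϖ, hϖ⟩ := exists_units_isUniformizer (F := F)
  have h1 : θ ϖ ∈ (weilSubgroup F).map (absGaloisAbProj F) := hθ.range_eq ▸ ⟨ϖ, rfl⟩
  obtain ⟨σ₀, -, hσ₀'⟩ := h1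
  have hfrob : IsFrobPow σ₀ 1 := hθ.isFrobPow_one_of_isUniformizer ϖ hϖ σ₀ hσ₀'
  have hdeg₀ : WeilGroup.deg (WeilGroup.mk σ₀ ⟨1, hfrob⟩) = 1 :=
    (WeilGroup.deg_eq_iff hmul huniq).mpr hfrob
  have hartin₀ : hθ.artin (WeilGroup.mk σ₀ ⟨1, hfrob⟩) = ϖ⁻¹ := by
    rw [artin_eq_iff, inv_inv, WeilGroup.toAbsGalois_mk, hσ₀']
  have hI : w * WeilGroup.mk σ₀ ⟨1, hfrob⟩ ∈ WeilGroup.inertia F := by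
    rw [← WeilGroup.deg_eq_zero_iff_mem_inertia hmul huniq, WeilGroup.deg_mul hmul huniq, hw, hdeg₀]
    norm_num
  have hu := artin_mem_unitGroup hθ hI
  rw [map_mul, hartin₀] at hu
  have h2 : hθ.artin w = hθ.artin w * ϖ⁻¹ * ϖ := by rw [inv_mul_cancel_right]
  rw [h2]
  exact isUniformizer_unitGroup_mul hϖ hu

/-- The closed subgroup `closure [Γ_F, Γ_F]` (kernel of `Γ_F → Γ_F^ab`) lies in `I_F`; hence an
element of `Γ_F` congruent to an inertia element modulo it is itself in `I_F`.
Ref: Serre, *Local Fields* (1979), Ch. XIII §4, p. 198 (`F_nr ⊆ F^ab`). [folklore] -/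
theorem mem_absInertia_of_absGaloisAbProj_eq (hdense : WeilGroup.denseRange_toAbsGalois F)
    {γ i : absoluteGaloisGroup F} (hi : i ∈ absInertia F)
    (h : absGaloisAbProj F γ = absGaloisAbProj F i) : γ ∈ absInertia F := by
  have hN := WeilGroup.topologicalClosure_commutator_absGalois_le_absInertia hdense
  have h0 : absGaloisAbProj F (i⁻¹ * γ) = 1 := by
    rw [map_mul, map_inv, h, inv_mul_cancel]
  have h1 : i⁻¹ * γ ∈ (commutator (absoluteGaloisGroup F)).topologicalClosure :=
    (QuotientGroup.eq_one_iff _).mp h0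
  have h2 : γ = i * (i⁻¹ * γ) := by rw [mul_inv_cancel_left]
  rw [h2]
  exact mul_mem hi (hN h1)

/-- `artin` is continuous for the Weil topology: on the open subgroup `I_F` it is the composite of
`I_F → 𝔗_F` (continuous, `continuous_toAbsGalois`) with the inverse of the homeomorphism
`θ : U_F ≃ 𝔗_F` (`isEmbedding_unitGroup`) and inversion.
Ref: Serre, *Local Fields* (1979), Ch. XIV §6, Cor. 2 (ii) and Remark 2. [folklore] -/
theorem continuous_artin (hθ : IsLocalReciprocityMap F θ) : Continuous hθ.artin := by
  haveI : IsTopologicalGroup (WeilGroup F) := WeilGroup.isTopologicalGroup_holds F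
  -- the map `I_F → U_F`, `i ↦ θ⁻¹ [i] = (artin i)⁻¹`
  let g : ↥((WeilGroup.inertia F : Set (WeilGroup F))) →
      ↥((valuation F).valuationSubring.unitGroup) :=
    fun i => ⟨(hθ.artin i.1)⁻¹, inv_mem (artin_mem_unitGroup hθ i.2)⟩
  have hg : Continuous g := by
    rw [hθ.isEmbedding_unitGroup.continuous_iff]
    have : (fun u : (valuation F).valuationSubring.unitGroup => θ u) ∘ g =
        fun i => absGaloisAbProj F (WeilGroup.toAbsGalois F i.1) := by
      funext i
      exact theta_artin_inv hθ i.1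
    rw [this]
    exact QuotientGroup.continuous_mk.comp
      (WeilGroup.continuous_toAbsGalois'.comp continuous_subtype_val)
  have hres : (WeilGroup.inertia F : Set (WeilGroup F)).restrict hθ.artin =
      fun i => ((g i : Fˣ))⁻¹ := by
    funext i
    simp [g]
  have hon : ContinuousOn hθ.artin (WeilGroup.inertia F : Set (WeilGroup F)) := by
    rw [continuousOn_iff_continuous_restrict, hres]
    exact (continuous_subtype_val.comp hg).inv
  exact continuous_of_continuousAt_one hθ.artin
    (hon.continuousAt ((WeilGroup.isOpen_inertia F).mem_nhds (one_mem _)))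

/-- `artin` is an open map: a neighbourhood of `1` in `W_F` contains `{i ∈ I_F | i ∈ V}` for some
Krull-open `V ∋ 1` (the Weil topology induces the Krull topology on the open subgroup `I_F`), and
its image contains `{x | x⁻¹ ∈ U_F, θ x⁻¹ ∈ [V]}`, which is open (`θ|U_F` continuous, `U_F` open,
`Γ_F → Γ_F^ab` open) — here one uses `closure [Γ_F, Γ_F] ≤ I_F` to see that every `γ ∈ V` with
`[γ] ∈ 𝔗_F` already lies in `I_F`.
Ref: Serre, *Local Fields* (1979), Ch. XIV §6, Cor. 2 (ii) and Remark 2. [folklore] -/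
theorem isOpenMap_artin (hθ : IsLocalReciprocityMap F θ)
    (hdense : WeilGroup.denseRange_toAbsGalois F) : IsOpenMap hθ.artin := by
  haveI : IsTopologicalGroup (WeilGroup F) := WeilGroup.isTopologicalGroup_holds F
  rw [IsTopologicalGroup.isOpenMap_iff_nhds_one, Filter.le_map_iff]
  intro s hs
  -- Step 1: an open `V ⊆ Γ_F` with `{i ∈ I_F | i ∈ V} = I_F ∩ interior s`.
  set I : Set (WeilGroup F) := (WeilGroup.inertia F : Set (WeilGroup F)) with hI
  have hopen : IsOpen ((Subtype.val : I → WeilGroup F) ⁻¹' interior s) :=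
    isOpen_interior.preimage continuous_subtype_val
  obtain ⟨V, hV, hVs⟩ :=
    (show IsEmbedding (I.restrict (WeilGroup.toAbsGalois F)) from
      WeilGroup.isEmbedding_toAbsGalois_restrict_inertia_holds F).isInducing.isOpen_iff.mp hopen
  have h1V : (1 : absoluteGaloisGroup F) ∈ V := by
    have h1 : (⟨1, one_mem _⟩ : I) ∈ (Subtype.val : I → WeilGroup F) ⁻¹' interior s :=
      mem_interior_iff_mem_nhds.mpr hs
    rw [← hVs] at h1
    simpa using h1
  -- Step 2: the open neighbourhood `T` of `1` in `Fˣ`.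
  set U : Subgroup Fˣ := (valuation F).valuationSubring.unitGroup with hU
  set T' : Set Fˣ := Subtype.val '' {u : U | θ u ∈ (absGaloisAbProj F) '' V} with hT'
  have hT'open : IsOpen T' := by
    refine (isOpen_unitGroup (F := F)).isOpenMap_subtype_val _ ?_
    exact (QuotientGroup.isOpenMap_coe V hV).preimage hθ.isEmbedding_unitGroup.continuous
  set T : Set Fˣ := (fun x : Fˣ => x⁻¹) ⁻¹' T' with hT
  have hTopen : IsOpen T := hT'open.preimage continuous_inv
  have h1T : (1 : Fˣ) ∈ T := by
    rw [hT, mem_preimage, inv_one, hT']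
    exact ⟨⟨1, one_mem _⟩, ⟨1, h1V, by simp⟩, rfl⟩
  refine mem_of_superset (hTopen.mem_nhds h1T) ?_
  -- Step 3: `T ⊆ artin '' s`.
  rintro x ⟨⟨u, hu⟩, ⟨γ, hγV, hγ⟩, hux⟩
  simp only at hux hγ
  -- `θ u = [γ]`, `u = x⁻¹`, `γ ∈ V`; `θ u ∈ θ(U_F) = [I_F]`, so `γ ∈ I_F`
  have h2 : θ u ∈ (absInertia F).map (absGaloisAbProj F) := hθ.map_unitGroup ▸ ⟨u, hu, rfl⟩
  obtain ⟨i, hi, hi'⟩ := h2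
  have hγI : γ ∈ absInertia F :=
    mem_absInertia_of_absGaloisAbProj_eq hdense hi (by rw [hi']; exact hγ)
  set w : WeilGroup F := WeilGroup.mk γ ⟨0, isFrobPow_zero_iff_mem_absInertia.mpr hγI⟩ with hw
  have hwI : w ∈ I := by
    rw [hI, SetLike.mem_coe, WeilGroup.mem_inertia_iff, hw, WeilGroup.toAbsGalois_mk]
    exact hγI
  have hws : w ∈ s := by
    have h3 : (⟨w, hwI⟩ : I) ∈ I.restrict (WeilGroup.toAbsGalois F) ⁻¹' V := by
      simpa [hw] using hγV
    rw [hVs] at h3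
    exact interior_subset h3
  refine ⟨w, hws, ?_⟩
  rw [artin_eq_iff, hw, WeilGroup.toAbsGalois_mk, ← hux]
  simpa using hγ.symm

/-- `artin` is an open quotient map `W_F → Fˣ`.
Ref: Serre, *Local Fields* (1979), Ch. XIV §6, Remark 2 (`K* ≅ 𝔄_K^0` as topological groups).
[folklore] -/
theorem isOpenQuotientMap_artin (hθ : IsLocalReciprocityMap F θ)
    (hdense : WeilGroup.denseRange_toAbsGalois F) : IsOpenQuotientMap hθ.artin :=
  ⟨artin_surjective hθ, continuous_artin hθ, isOpenMap_artin hθ hdense⟩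

variable (hθ : IsLocalReciprocityMap F θ)

/-- **From the reciprocity map to the local Artin datum.**  A homomorphism `θ : Fˣ → Γ_F^ab`
with the printed properties of Serre's reciprocity map yields, given the density of `W_F` in
`Γ_F` (the named fact `WeilGroup.denseRange_toAbsGalois`), a `LocalArtinData F` with
`artin w = (θ⁻¹ [w])⁻¹` (Deligne's normalisation).
Ref: Tate, *Number theoretic background* (Corvallis 1979), (1.4.1); Serre, *Local Fields* (1979),
Ch. XIV §6, Remark 2. [folklore] -/
def toLocalArtinData (hdense : WeilGroup.denseRange_toAbsGalois F) : LocalArtinData F where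
  artin := hθ.artin
  isOpenQuotientMap_artin := isOpenQuotientMap_artin hθ hdense
  ker_artin := coe_ker_artin hθ hdense
  image_inertia := map_inertia_artin hθ
  artin_frob := isUniformizer_artin hθ

/-- Unfolding lemma: the Artin map of `toLocalArtinData` is `artin`.
Ref: Tate, Corvallis 1979, (1.4.1). [folklore] -/
@[simp]
theorem toLocalArtinData_artin (hdense : WeilGroup.denseRange_toAbsGalois F) :
    (hθ.toLocalArtinData hdense).artin = hθ.artin :=
  rfl

end IsLocalReciprocityMap

/-! ### Norm functoriality -/

section Compatible

variable {F E : Type*} [Field F] [ValuativeRel F] [TopologicalSpace F]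
  [IsNonarchimedeanLocalField F] [Field E] [ValuativeRel E] [TopologicalSpace E]
  [IsNonarchimedeanLocalField E] [Algebra F E]
variable {θF : Fˣ →* absoluteGaloisGroupAbelianization F}
  {θE : Eˣ →* absoluteGaloisGroupAbelianization E}

/-- **Norm functoriality passes from `θ` to `artin`.**  If `θ_F ∘ N_{E/F} = i ∘ θ_E`
(`IsNormCompatible`), then the Artin data built from `θ_F`, `θ_E` satisfy
`artin_F (res w) = N_{E/F} (artin_E w)` for `w ∈ W_E` (`LocalArtinData.IsCompatible`):
`θ_F (N (artin_E w)⁻¹) = i (θ_E (artin_E w)⁻¹) = i [w] = [res w]`.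
Ref: Serre, *Local Fields* (1979), Ch. XIII §4, Prop. 10 (a) and Ch. XIV §6, Exercise 1; Serre in
Cassels–Fröhlich (1967), Ch. VI §2.4. [folklore] -/
theorem IsLocalReciprocityMap.isCompatible (hθF : IsLocalReciprocityMap F θF)
    (hθE : IsLocalReciprocityMap E θE) (hN : IsNormCompatible F E θF θE)
    (hdF : WeilGroup.denseRange_toAbsGalois F) (hdE : WeilGroup.denseRange_toAbsGalois E)
    (h : (weilSubgroup E).map (absGaloisRestrict F E).toMonoidHom ≤ weilSubgroup F) :
    (hθF.toLocalArtinData hdF).IsCompatible (hθE.toLocalArtinData hdE) h := by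
  intro w
  change hθF.artin (WeilGroup.map F E h w) = Units.map (Algebra.norm F : E →* F) (hθE.artin w)
  rw [hθF.artin_eq_iff, ← map_inv, hN, WeilGroup.toAbsGalois_map, ← absGaloisRestrictAb_mk,
    hθE.theta_artin_inv]

end Compatible

/-! ### Assembly: the facts of `LocalClassFieldTheory.lean` from the reciprocity-map facts -/

section Assembly

universe u v

/-- **Existence of the local Artin map from local class field theory** (conditional discharge of
`Literature.NumberTheory.GaloisRepresentations.nonempty_localArtinData` at one field): the reciprocity-map fact
`exists_isLocalReciprocityMap F` and the density of `W_F` in `Γ_F` give a `LocalArtinData F`.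
Ref: Serre, *Local Fields* (1979), Ch. XIII §4, Ch. XIV §6 (Remark 2); Tate, Corvallis 1979,
(1.4.1). [folklore] -/
theorem nonempty_localArtinData_of_isLocalReciprocityMap {F : Type u} [Field F] [ValuativeRel F]
    [TopologicalSpace F] [IsNonarchimedeanLocalField F]
    (hdense : WeilGroup.denseRange_toAbsGalois F) (hrec : exists_isLocalReciprocityMap F) :
    Nonempty (LocalArtinData F) := by
  obtain ⟨θ, hθ⟩ := hrec
  exact ⟨hθ.toLocalArtinData hdense⟩

/-- **`Literature.NumberTheory.GaloisRepresentations.nonempty_localArtinData` from the named facts**: local class field theory (the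
reciprocity map with its printed properties, `exists_isLocalReciprocityMap`) and the density of
the Weil group (`WeilGroup.denseRange_toAbsGalois`), for every non-archimedean local field, give
the fact `nonempty_localArtinData`.
Ref: Serre, *Local Fields* (1979), Ch. XIII §4, Ch. XIV §6; Tate, Corvallis 1979, (1.4.1).
[folklore] -/
theorem nonempty_localArtinData_of_localReciprocity
    (hdense : ∀ (F : Type u) [Field F] [ValuativeRel F] [TopologicalSpace F]
      [IsNonarchimedeanLocalField F], WeilGroup.denseRange_toAbsGalois F)
    (hrec : ∀ (F : Type u) [Field F] [ValuativeRel F] [TopologicalSpace F]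
      [IsNonarchimedeanLocalField F], exists_isLocalReciprocityMap F) :
    nonempty_localArtinData.{u} :=
  fun F _ _ _ _ => nonempty_localArtinData_of_isLocalReciprocityMap (hdense F) (hrec F)

/-- **`Literature.NumberTheory.GaloisRepresentations.exists_isCompatible` from the named facts** (norm functoriality of the local Artin
map): for a non-archimedean local field `F`, the density of the Weil groups of `F` and of its
finite extensions `E` in the absolute Galois groups (`WeilGroup.denseRange_toAbsGalois`), together
with local class field theory with norm functoriality
(`exists_isLocalReciprocityMap_normCompatible F E`), give `exists_isCompatible F`.
Ref: Serre, *Local Fields* (1979), Ch. XIII §4, Prop. 10; Serre in Cassels–Fröhlich (1967),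
Ch. VI §2.4; Tate, Corvallis 1979, (1.4.1)–(1.4.6). [folklore] -/
theorem exists_isCompatible_of_localReciprocity {F : Type u} [Field F] [ValuativeRel F]
    [TopologicalSpace F] [IsNonarchimedeanLocalField F] (hdF : WeilGroup.denseRange_toAbsGalois F)
    (hdE : ∀ (E : Type v) [Field E] [ValuativeRel E] [TopologicalSpace E]
      [IsNonarchimedeanLocalField E], WeilGroup.denseRange_toAbsGalois E)
    (hrec : ∀ (E : Type v) [Field E] [ValuativeRel E] [TopologicalSpace E]
      [IsNonarchimedeanLocalField E] [Algebra F E] [FiniteDimensional F E] [ValuativeExtension F E],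
      exists_isLocalReciprocityMap_normCompatible F E) :
    exists_isCompatible.{u, v} F := by
  intro E _ _ _ _ _ _ _ h
  obtain ⟨θF, θE, hθF, hθE, hN⟩ := hrec E
  exact ⟨hθF.toLocalArtinData hdF, hθE.toLocalArtinData (hdE E),
    hθF.isCompatible hθE hN hdF (hdE E) h⟩

/-- **`Literature.NumberTheory.GaloisRepresentations.nonempty_localArtinData` from local class field theory alone**: the reciprocity-map
fact `exists_isLocalReciprocityMap` for every non-archimedean local field gives the fact
`nonempty_localArtinData` (density of the Weil group being the theorem
`WeilGroup.denseRange_toAbsGalois_holds`).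
Ref: Serre, *Local Fields* (1979), Ch. XIII §4, Ch. XIV §6; Tate, Corvallis 1979, (1.4.1).
[folklore] -/
theorem nonempty_localArtinData_of_lcft
    (hrec : ∀ (F : Type u) [Field F] [ValuativeRel F] [TopologicalSpace F]
      [IsNonarchimedeanLocalField F], exists_isLocalReciprocityMap F) :
    nonempty_localArtinData.{u} :=
  nonempty_localArtinData_of_localReciprocity
    (fun F _ _ _ _ => WeilGroup.denseRange_toAbsGalois_holds F) hrec

/-- **`Literature.NumberTheory.GaloisRepresentations.exists_isCompatible` from local class field theory alone** (norm functoriality of the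
local Artin map): for a non-archimedean local field `F`, local class field theory with norm
functoriality for its finite extensions (`exists_isLocalReciprocityMap_normCompatible F E`, Serre,
*Local Fields*, XIII §4 Prop. 10 with XIV §6) gives `exists_isCompatible F`; the density inputs of
`exists_isCompatible_of_localReciprocity` are the theorem `WeilGroup.denseRange_toAbsGalois_holds`.
Ref: Serre, *Local Fields* (1979), Ch. XIII §4, Prop. 10; Serre in Cassels–Fröhlich (1967),
Ch. VI §2.4; Tate, Corvallis 1979, (1.4.1)–(1.4.6). [folklore] -/
theorem exists_isCompatible_of_lcft {F : Type u} [Field F] [ValuativeRel F]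
    [TopologicalSpace F] [IsNonarchimedeanLocalField F]
    (hrec : ∀ (E : Type v) [Field E] [ValuativeRel E] [TopologicalSpace E]
      [IsNonarchimedeanLocalField E] [Algebra F E] [FiniteDimensional F E] [ValuativeExtension F E],
      exists_isLocalReciprocityMap_normCompatible F E) :
    exists_isCompatible.{u, v} F :=
  exists_isCompatible_of_localReciprocity (WeilGroup.denseRange_toAbsGalois_holds F)
    (fun E _ _ _ _ => WeilGroup.denseRange_toAbsGalois_holds E) hrec

end Assembly

end Literature.NumberTheory.GaloisRepresentations
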